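import Literature.NumberTheory.LFunctions.RademacherDirichletLConvexity
import Literature.NumberTheory.LFunctions.DirichletLFunctionBounds
import Literature.NumberTheory.LFunctions.ZetaFractionalPartIntegral
import Literature.NumberTheory.LFunctions.ZetaRealAxis
import Literature.NumberTheory.LFunctions.SiegelAbelSummation
import Literature.NumberTheory.LFunctions.PrimitiveQuadraticCharacterGaussSum
import Literature.Analysis.SpecialFunctions.GammaStirlingVertical
import Mathlib.NumberTheory.LSeries.Nonvanishing
import Mathlib.NumberTheory.Harmonic.ZetaAsymp
import HarnessLib

/-!
# The product `ζ(s) L(s, χ)` for a real character: Dirichlet series, the pole, the reflection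
# bound on `Re s = −3/2`, polynomial growth in `−3/2 ≤ Re s ≤ 2`, and its sign on the real axis

Topic `Literature/NumberTheory/LFunctions`. Everything in this file is PROVED (no named fact).
This is the `ζ_k`-section of the discharge of the tree's named fact
`Literature.NumberTheory.LFunctions.hoffstein1980_lemma1` (J. Hoffstein, *On the Siegel–Tatuzawa
theorem*, Acta Arith. **38** (1980) 167–174, Lemma 1): for the quadratic field `k` of discriminant
`d`, `ζ_k(s) = ζ(s) L(s, χ_d)`; we work directly with the product `F(s) = ζ(s) L(s, χ)` for a
Dirichlet character `χ` (`zetaL χ`), which for `χ` quadratic has the non-negative coefficients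
`(1 ∗ χ)(n)` (Mathlib's `DirichletCharacter.zetaMul`).

* `zetaL_eq_LSeries` — `F(s) = Σ (1∗χ)(n) n^{-s}` for `Re s > 1` ("Since for `Re s > 1`,
  `ζ_k(s) = Σ (N𝔞)^{-s}` …", p. 169); `summable_norm_term_zetaMul`.
* `differentiableAt_zetaL`, `zetaL_eq_div_near_one` — `F` is holomorphic off `s = 1`, where it has
  a simple pole with residue `L(1, χ)` (the term `L(1,χ) x^{1−β}/((1−β)∏(n+1−β))` of (3), p. 169).
* `norm_zetaL_neg_three_halves_le` — **the input of (1), p. 168**: by the functional equations,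
  `|ζ_k(−3/2 + it)| = (|d|/(2π)²)² |Γ-quotients| |ζ_k(5/2 − it)|` with
  `|Γ(5/2 − it) Γ(−3/2 + it)⁻¹| = |3/2 + it|² |1/2 + it|²` resp. `(1/16)|3/2+it|²|1/2+it|²` in the
  real-quadratic case, and `|ζ_k(5/2 − it)| ≤ ζ_k(5/2) ≤ ζ(5/2)²`; here:
  `‖F(−3/2 + it)‖ ≤ q² (9/4 + t²)(1/4 + t²) Z₀(5/2)² / (16 π⁴)` for `χ` primitive mod `q > 1`
  (`Z₀ = Booker2006Turing.bigZ`, `Z₀(σ) = ζ(σ)`). (Hoffstein bounds `ζ_k(5/2) ≤ ζ(2)² = π⁴/36`.)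
* `exists_norm_zetaL_le_pow` — polynomial growth `‖F(σ + it)‖ ≤ C |t|⁴` on `−3/2 ≤ σ ≤ 2`,
  `|t| ≥ 2` (functional equations and Stirling's formula; needed to move the line of integration
  in (3), p. 169).
* `zetaL_ofReal_re_nonpos`, `zetaL_ofReal_pos_of_mem_Ioo` — the signs used after (3), p. 169:
  "`−ζ_k(−2+β) < 0` and `ζ_k(β) ≤ 0`": `F(σ) ≤ 0` for `0 < σ < 1` when `L(·,χ)` has no zero on
  `[σ, 1]`, and `F(σ) > 0` for `−2 < σ < −1` (from the functional equations and the sign of `Γ` on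
  `(−1, 0)`; for `L` this uses the root number `ε(χ) = 1` of a real primitive character, the tree's
  `PrimitiveQuadratic.rootNumber_eq_one_of_isQuadratic`).

## References

* J. Hoffstein, On the Siegel–Tatuzawa theorem, Acta Arith. 38 (1980) 167–174, §2, proof of
  Lemma 1, pp. 168–169. [Hoffstein1980SiegelTatuzawa]
* H. L. Montgomery, R. C. Vaughan, *Multiplicative Number Theory I*, CUP 2007, §10.1 Cor. 10.10
  (growth in vertical strips). [MontgomeryVaughan2007]
-/

noncomputable section

open Complex Set Filter Topology DirichletCharacter
open scoped Real

namespace Literature.NumberTheory.LFunctions.Hoffstein1980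

open Literature.NumberTheory.LFunctions.Booker2006Turing

variable {q : ℕ} [NeZero q]

/-! ### The product and its Dirichlet series -/

/-- `F(s) = ζ(s) L(s, χ)` — for `χ = χ_d` the Dedekind zeta function `ζ_k` of `k = ℚ(√d)`.
[cite: Hoffstein1980SiegelTatuzawa, §2 proof of Lemma 1 p. 168] -/
def zetaL (χ : DirichletCharacter ℂ q) (s : ℂ) : ℂ := riemannZeta s * χ.LFunction s

/-- **`F(s) = Σ (1 ∗ χ)(n) n^{-s}` for `Re s > 1`** ("for `Re s > 1`, `ζ_k(s) = Σ (N𝔞)^{-s}`").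
[cite: Hoffstein1980SiegelTatuzawa, §2 proof of Lemma 1 p. 169] -/
theorem zetaL_eq_LSeries (χ : DirichletCharacter ℂ q) {s : ℂ} (hs : 1 < s.re) :
    zetaL χ s = LSeries (fun n ↦ χ.zetaMul n) s := by
  unfold zetaL
  rw [DirichletCharacter.zetaMul, ← ArithmeticFunction.coe_mul, LSeries_convolution']
  · rw [χ.LFunction_eq_LSeries hs]
    congr 1
    · simp_rw [← ArithmeticFunction.LSeries_zeta_eq_riemannZeta hs, ← ArithmeticFunction.natCoe_apply]
    · exact LSeries_congr (χ.apply_eq_toArithmeticFunction_apply ·) s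
  · exact ArithmeticFunction.LSeriesSummable_zeta_iff.mpr hs
  · exact (LSeriesSummable_congr _ fun h ↦ (χ.apply_eq_toArithmeticFunction_apply h).symm).mpr <|
      ZMod.LSeriesSummable_of_one_lt_re χ hs

omit [NeZero q] in
/-- Absolute convergence: `Σ ‖(1∗χ)(n) n^{-s}‖ < ∞` for `Re s > 1`.
[cite: Hoffstein1980SiegelTatuzawa, §2 proof of Lemma 1 p. 169] -/
theorem summable_norm_term_zetaMul (χ : DirichletCharacter ℂ q) {s : ℂ} (hs : 1 < s.re) :
    Summable fun n : ℕ ↦ ‖LSeries.term (fun n ↦ χ.zetaMul n) s n‖ :=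
  summable_norm_iff.mpr (χ.LSeriesSummable_zetaMul hs)

/-! ### Holomorphy and the pole at `s = 1` -/

/-- `F` is complex differentiable at every `s ≠ 1` (for `χ ≠ 1`).
[cite: Hoffstein1980SiegelTatuzawa, §2 proof of Lemma 1 p. 169] -/
theorem differentiableAt_zetaL {χ : DirichletCharacter ℂ q} (hχ : χ ≠ 1) {s : ℂ} (hs : s ≠ 1) :
    DifferentiableAt ℂ (zetaL χ) s :=
  (differentiableAt_riemannZeta hs).mul (differentiable_LFunction hχ s)

/-- The regularised zeta function `(s − 1)ζ(s)` (value `1` at `s = 1`; `ζ(s) − 1/(s−1)` is entire). [cite: Titchmarsh1986, §2.1] -/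
def zetaReg1 : ℂ → ℂ := Function.update (fun s : ℂ ↦ (s - 1) * riemannZeta s) 1 1

/-- `zetaReg1 s = (s − 1) ζ(s)` for `s ≠ 1`. [cite: Titchmarsh1986, §2.1] -/
theorem zetaReg1_of_ne_one {s : ℂ} (hs : s ≠ 1) : zetaReg1 s = (s - 1) * riemannZeta s :=
  Function.update_of_ne hs _ _

/-- `zetaReg1 1 = 1` (the residue of `ζ` at `1`). [cite: Titchmarsh1986, §2.1] -/
theorem zetaReg1_one : zetaReg1 1 = 1 := Function.update_self ..

/-- `(s − 1)ζ(s)` is analytic at `1` (Riemann's removable singularity theorem and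
`riemannZeta_residue_one`). [cite: Titchmarsh1986, §2.1] -/
theorem analyticAt_zetaReg1 : AnalyticAt ℂ zetaReg1 1 := by
  refine analyticAt_of_differentiable_on_punctured_nhds_of_continuousAt ?_ ?_
  · filter_upwards [self_mem_nhdsWithin] with z hz
    have hz' : z ≠ 1 := hz
    have hev : zetaReg1 =ᶠ[𝓝 z] fun s : ℂ ↦ (s - 1) * riemannZeta s := by
      filter_upwards [isOpen_ne.mem_nhds hz'] with w hw
      exact zetaReg1_of_ne_one hw
    refine DifferentiableAt.congr_of_eventuallyEq ?_ hev
    exact ((differentiableAt_id.sub (differentiableAt_const _)).mul (differentiableAt_riemannZeta hz'))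
  · exact continuousAt_update_same.2 riemannZeta_residue_one

/-- `(s − 1)ζ(s)` (regularised at `1`) is entire. [cite: Titchmarsh1986, §2.1] -/
theorem differentiable_zetaReg1 : Differentiable ℂ zetaReg1 := by
  intro z
  rcases eq_or_ne z 1 with rfl | hz
  · exact analyticAt_zetaReg1.differentiableAt
  · have hev : zetaReg1 =ᶠ[𝓝 z] fun s : ℂ ↦ (s - 1) * riemannZeta s := by
      filter_upwards [isOpen_ne.mem_nhds hz] with w hw
      exact zetaReg1_of_ne_one hw
    refine DifferentiableAt.congr_of_eventuallyEq ?_ hev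
    exact ((differentiableAt_id.sub (differentiableAt_const _)).mul (differentiableAt_riemannZeta hz))

/-- **The simple pole of `F` at `s = 1` with residue `L(1, χ)`**, in the concrete form used by the
tree's residue theorem: `F(s) = φ(s)/(s − 1)` for `s ≠ 1` with the entire function
`φ = zetaReg1 · L(·,χ)`, `φ(1) = L(1,χ)`. [cite: Hoffstein1980SiegelTatuzawa, §2 proof of Lemma 1 (3) p. 169] -/
theorem zetaL_eq_div_of_ne_one (χ : DirichletCharacter ℂ q) {s : ℂ} (hs : s ≠ 1) :
    zetaL χ s = zetaReg1 s * χ.LFunction s / (s - 1) := by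
  rw [zetaReg1_of_ne_one hs, zetaL]
  field_simp [sub_ne_zero.2 hs]

/-- `φ(1) = L(1, χ)` for `φ = zetaReg1 · L(·,χ)` (the residue of `F` at `1`).
[cite: Hoffstein1980SiegelTatuzawa, §2 proof of Lemma 1 (3) p. 169] -/
theorem zetaReg1_mul_LFunction_one (χ : DirichletCharacter ℂ q) :
    zetaReg1 1 * χ.LFunction 1 = χ.LFunction 1 := by rw [zetaReg1_one, one_mul]

/-! ### The reflection bound on the line `Re s = −3/2` (Hoffstein's input to (1)) -/

/-- The `Γ`-quotient of the functional equation two units to the left: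
`‖Γ(2 + z̄)‖ = ‖z‖ ‖z + 1‖ ‖Γ(z)‖` (`Γ(w+1) = wΓ(w)` twice and `Γ(z̄) = conj Γ(z)`); for
`z = (−3/2 + it)/2` this is Hoffstein's `|Γ(5/4 − it/2) Γ(−3/4 + it/2)⁻¹|² = (1/16)|3/2+it|²|1/2+it|²`.
[cite: Hoffstein1980SiegelTatuzawa, §2 proof of Lemma 1 p. 168] -/
theorem norm_Gamma_two_add_conj (z : ℂ) (h0 : z ≠ 0) (h1 : z + 1 ≠ 0) :
    ‖Gamma (2 + (starRingEnd ℂ) z)‖ = ‖z‖ * ‖z + 1‖ * ‖Gamma z‖ := by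
  set w : ℂ := (starRingEnd ℂ) z with hw
  have hw0 : w ≠ 0 := by rw [hw]; exact (map_ne_zero _).2 h0
  have hw1 : w + 1 ≠ 0 := by
    rw [hw]; intro h
    apply h1
    have : (starRingEnd ℂ) (z + 1) = 0 := by rw [map_add, map_one]; exact h
    exact (map_eq_zero _).1 this
  have h2 : Gamma (2 + w) = (w + 1) * (w * Gamma w) := by
    rw [show (2 : ℂ) + w = (w + 1) + 1 by ring, Complex.Gamma_add_one _ hw1, Complex.Gamma_add_one _ hw0]
  rw [h2, norm_mul, norm_mul, hw, Complex.Gamma_conj, Complex.norm_conj, Complex.norm_conj,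
    show (starRingEnd ℂ) z + 1 = (starRingEnd ℂ) (z + 1) by rw [map_add, map_one], Complex.norm_conj]
  ring

/-- `Γ(z) ≠ 0` when `Re z` is not an integer `≤ 0`; here for `Re z ∈ {−3/4, −1/4}`. [folklore] -/
private lemma Gamma_ne_zero_of_re {z : ℂ} (hz : ∀ m : ℕ, z.re ≠ -m) : Gamma z ≠ 0 := by
  refine Complex.Gamma_ne_zero fun m hm ↦ hz m ?_
  rw [hm]; simp

/-- The common size of the two `Γ`-quotients: for `z = −3/4 + it/2` or `z = −1/4 + it/2`,
`(‖z‖ ‖z+1‖)² = (9/4 + t²)(1/4 + t²)/16`. [folklore] -/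
private lemma norm_mul_norm_sq_eq (t : ℝ) {c : ℝ} (hc : c = -3 / 4 ∨ c = -1 / 4) :
    (‖(c : ℂ) + t / 2 * I‖ * ‖(c : ℂ) + t / 2 * I + 1‖) ^ 2 = (9 / 4 + t ^ 2) * (1 / 4 + t ^ 2) / 16 := by
  have h1 : ‖(c : ℂ) + t / 2 * I‖ ^ 2 = c ^ 2 + t ^ 2 / 4 := by
    rw [Complex.sq_norm, Complex.normSq_apply]; simp; ring
  have h2 : ‖(c : ℂ) + t / 2 * I + 1‖ ^ 2 = (c + 1) ^ 2 + t ^ 2 / 4 := by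
    rw [Complex.sq_norm, Complex.normSq_apply]; simp; ring
  rw [mul_pow, h1, h2]
  rcases hc with hc | hc <;> subst hc <;> ring

/-- **`|ζ(−3/2 + it)| = (1/(4π²)) |3/2 + it| |1/2 + it| |ζ(5/2 − it)|`** in the form
`‖ζ(−3/2 + it)‖ = X₁ · π^{-2} · ‖ζ(5/2 − it)‖` with `X₁ = ‖z‖‖z+1‖`, `z = −3/4 + it/2` (the
functional equation `Λ(s) = Λ(1−s)` and `norm_Gamma_two_add_conj`).
[cite: Hoffstein1980SiegelTatuzawa, §2 proof of Lemma 1 p. 168] -/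
theorem norm_riemannZeta_neg_three_halves (t : ℝ) :
    ‖riemannZeta (-3 / 2 + t * I)‖ =
      ‖((-3 / 4 : ℝ) : ℂ) + t / 2 * I‖ * ‖((-3 / 4 : ℝ) : ℂ) + t / 2 * I + 1‖ * π ^ (-2 : ℝ) *
        ‖riemannZeta (5 / 2 - t * I)‖ := by
  set s : ℂ := -3 / 2 + t * I with hs
  set z : ℂ := ((-3 / 4 : ℝ) : ℂ) + t / 2 * I with hz
  have hs0 : s ≠ 0 := fun h ↦ by have := congrArg Complex.re h; simp [hs] at this
  have h1s : (1 : ℂ) - s = 5 / 2 - t * I := by rw [hs]; ring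
  have h1s0 : (1 : ℂ) - s ≠ 0 := fun h ↦ by
    have := congrArg Complex.re h; simp [hs] at this; norm_num at this
  have hre1 : 0 < ((1 : ℂ) - s).re := by simp [hs]; norm_num
  have hΓ1 : Gammaℝ (1 - s) ≠ 0 := Complex.Gammaℝ_ne_zero_of_re_pos hre1
  -- `ζ(s) = ζ(1-s) Γℝ(1-s) / Γℝ(s)`
  have hζ : riemannZeta s = riemannZeta (1 - s) * Gammaℝ (1 - s) / Gammaℝ s := by
    rw [riemannZeta_def_of_ne_zero hs0, ← completedRiemannZeta_one_sub, riemannZeta_def_of_ne_zero h1s0]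
    field_simp
  -- the `Γℝ`-quotient
  have hz2 : s / 2 = z := by rw [hs, hz]; push_cast; ring
  have hconj : (starRingEnd ℂ) z = ((-3 / 4 : ℝ) : ℂ) - t / 2 * I := by
    apply Complex.ext
    · rw [Complex.conj_re, hz]; simp
    · rw [Complex.conj_im, hz]; simp
  have hz1 : (1 - s) / 2 = 2 + (starRingEnd ℂ) z := by
    rw [hconj, hs]; push_cast; ring
  have hz0 : z ≠ 0 := fun h ↦ by have := congrArg Complex.re h; simp [hz] at this
  have hz1' : z + 1 ≠ 0 := fun h ↦ by have := congrArg Complex.re h; simp [hz] at this; norm_num at this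
  have hΓz : Gamma z ≠ 0 := Gamma_ne_zero_of_re (fun m h ↦ by
    simp [hz] at h
    have : (4 : ℝ) * m = 3 := by linarith
    have h3 : 4 ∣ (3 : ℕ) := ⟨m, by exact_mod_cast this.symm⟩
    omega)
  have hquot : Gammaℝ (1 - s) / Gammaℝ s = (π : ℂ) ^ (s - 1 / 2) * (Gamma (2 + (starRingEnd ℂ) z) / Gamma z) := by
    rw [Complex.Gammaℝ_def, Complex.Gammaℝ_def, hz1, hz2]
    have hπ : (π : ℂ) ≠ 0 := ofReal_ne_zero.2 Real.pi_ne_zero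
    rw [show -(1 - s) / 2 = (s - 1 / 2) + (-s / 2) by ring, cpow_add _ _ hπ]
    have hπs : (π : ℂ) ^ (-s / 2) ≠ 0 := cpow_ne_zero_iff_of_exponent_ne_zero (by
      intro h; apply hs0; linear_combination (-2) * h) |>.2 hπ
    field_simp
  rw [hζ, mul_div_assoc, hquot, h1s]
  rw [norm_mul, norm_mul, norm_div, norm_Gamma_two_add_conj z hz0 hz1',
    Complex.norm_cpow_eq_rpow_re_of_pos Real.pi_pos]
  have hre : (s - 1 / 2).re = -2 := by simp [hs]; norm_num
  rw [hre]
  have hΓn : ‖Gamma z‖ ≠ 0 := norm_ne_zero_iff.2 hΓz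
  field_simp

/-- **`|L(−3/2 + it, χ)| = (k²/(4π²))|3/2+it||1/2+it||L(5/2 − it, χ̄)|`** for a primitive `χ`
modulo `k > 1`, in the form `‖L(−3/2+it, χ)‖ = X₂ (q²/π²) ‖L(5/2 − it, χ⁻¹)‖` with
`X₂ = ‖z‖‖z+1‖`, `z = (a − 3/2 + it)/2`, `a ∈ {0,1}` the parity
(Rademacher's form of the functional equation, `Rademacher1959.norm_LFunction_eq_reflect`).
[cite: Hoffstein1980SiegelTatuzawa, §2 proof of Lemma 1 p. 168] -/
theorem norm_LFunction_neg_three_halves (hq : 1 < q) {χ : DirichletCharacter ℂ q}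
    (hχ : χ.IsPrimitive) (t : ℝ) :
    ∃ c : ℝ, (c = -3 / 4 ∨ c = -1 / 4) ∧
      ‖χ.LFunction (-3 / 2 + t * I)‖ =
        ‖(c : ℂ) + t / 2 * I‖ * ‖(c : ℂ) + t / 2 * I + 1‖ * ((q : ℝ) ^ 2 / π ^ 2) *
          ‖χ⁻¹.LFunction (5 / 2 - t * I)‖ := by
  set s : ℂ := -3 / 2 + t * I with hs
  have hsre : s.re = -3 / 2 := by simp [hs]
  have h := Rademacher1959.norm_LFunction_eq_reflect hq hχ (s := s) (by rw [hsre]; norm_num)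
  set a : ℕ := charParity χ with ha
  have ha1 : a = 0 ∨ a = 1 := by
    have := charParity_le_one χ; rw [← ha] at this; omega
  set c : ℝ := (a : ℝ) / 2 - 3 / 4 with hc
  refine ⟨c, ?_, ?_⟩
  · rcases ha1 with h0 | h1
    · left; rw [hc, h0]; norm_num
    · right; rw [hc, h1]; norm_num
  set z : ℂ := (c : ℂ) + t / 2 * I with hz
  have hz2 : (a : ℂ) / 2 + s / 2 = z := by rw [hs, hz, hc]; push_cast; ring
  have hconj : (starRingEnd ℂ) z = (c : ℂ) - t / 2 * I := by
    apply Complex.ext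
    · rw [Complex.conj_re, hz]; simp
    · rw [Complex.conj_im, hz]; simp
  have hz1 : (a : ℂ) / 2 + (1 - s) / 2 = 2 + (starRingEnd ℂ) z := by
    rw [hconj, hs, hc]; push_cast; ring
  have hz0 : z ≠ 0 := fun h ↦ by
    have := congrArg Complex.re h; simp [hz, hc] at this
    rcases ha1 with h0 | h1
    · rw [h0] at this; norm_num at this
    · rw [h1] at this; norm_num at this
  have hz1' : z + 1 ≠ 0 := fun h ↦ by
    have := congrArg Complex.re h; simp [hz, hc] at this
    rcases ha1 with h0 | h1
    · rw [h0] at this; norm_num at this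
    · rw [h1] at this; norm_num at this
  have h1s : (1 : ℂ) - s = 5 / 2 - t * I := by rw [hs]; ring
  rw [hz1, hz2, norm_div, norm_Gamma_two_add_conj z hz0 hz1', hsre, h1s] at h
  have hΓz : Gamma z ≠ 0 := Gamma_ne_zero_of_re (fun m h' ↦ by
    simp [hz, hc] at h'
    rcases ha1 with h0 | h1
    · rw [h0] at h'; norm_num at h'
      have : (4 : ℝ) * m = 3 := by linarith
      have h3 : 4 ∣ (3 : ℕ) := ⟨m, by exact_mod_cast this.symm⟩
      omega
    · rw [h1] at h'; norm_num at h'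
      have : (4 : ℝ) * m = 1 := by linarith
      have h3 : 4 ∣ (1 : ℕ) := ⟨m, by exact_mod_cast this.symm⟩
      omega)
  have hΓn : ‖Gamma z‖ ≠ 0 := norm_ne_zero_iff.2 hΓz
  rw [h]
  have hqpos : (0 : ℝ) < q := by exact_mod_cast (zero_lt_one.trans hq)
  have hπq : (π / q : ℝ) ^ ((-3 / 2 : ℝ) - 1 / 2) = (q : ℝ) ^ 2 / π ^ 2 := by
    rw [show ((-3 / 2 : ℝ) - 1 / 2) = -2 by norm_num, Real.rpow_neg (by positivity), Real.div_rpow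
      Real.pi_pos.le hqpos.le, Real.rpow_two, Real.rpow_two]
    field_simp
  rw [hπq]
  field_simp

/-- `|ζ(σ − it)| ≤ Z₀(σ) = ζ(σ)` for `σ > 1` (Mathlib: `ζ = L(·, 1 mod 1)`).
[cite: Hoffstein1980SiegelTatuzawa, §2 proof of Lemma 1 p. 168] -/
theorem norm_riemannZeta_le_bigZ {σ : ℝ} (hσ : 1 < σ) (t : ℝ) :
    ‖riemannZeta (σ + t * I)‖ ≤ bigZ σ := by
  have h := norm_LFunction_le_bigZ (1 : DirichletCharacter ℂ 1) hσ t
  rwa [DirichletCharacter.LFunction_modOne_eq] at h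

/-- `Z₀(σ) = ζ(σ) = Σ_{n ≥ 1} n^{-σ}` as a real series (`σ > 1`). [cite: Titchmarsh1986, §1.1 (1.1.1)] -/
theorem bigZ_eq_tsum {σ : ℝ} (hσ : 1 < σ) : bigZ σ = ∑' n : ℕ, ((n + 1 : ℕ) : ℝ) ^ (-σ) := by
  have hs : 1 < (σ : ℂ).re := by simp [hσ]
  rw [bigZ, zeta_eq_tsum_one_div_nat_add_one_cpow hs]
  have hterm : ∀ n : ℕ, (1 : ℂ) / ((n : ℂ) + 1) ^ (σ : ℂ) = ((((n + 1 : ℕ) : ℝ) ^ (-σ) : ℝ) : ℂ) := by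
    intro n
    have hn : (0 : ℝ) ≤ ((n + 1 : ℕ) : ℝ) := Nat.cast_nonneg _
    rw [Real.rpow_neg hn, ofReal_inv, ofReal_cpow hn, one_div]
    push_cast
    ring_nf
  simp_rw [hterm]
  rw [← ofReal_tsum, ofReal_re]

/-- `ζ` is antitone on `(1, ∞)`: `ζ(σ₂) ≤ ζ(σ₁)` for `1 < σ₁ ≤ σ₂` (termwise in (1.1.1)). [cite: Titchmarsh1986, §1.1 (1.1.1)] -/
theorem bigZ_antitone' {σ₁ σ₂ : ℝ} (h1 : 1 < σ₁) (h12 : σ₁ ≤ σ₂) : bigZ σ₂ ≤ bigZ σ₁ := by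
  rw [bigZ_eq_tsum h1, bigZ_eq_tsum (h1.trans_le h12)]
  have hsum : ∀ σ : ℝ, 1 < σ → Summable fun n : ℕ ↦ ((n + 1 : ℕ) : ℝ) ^ (-σ) := by
    intro σ hσ
    have := (Real.summable_nat_rpow.2 (show -σ < -1 by linarith))
    exact (summable_nat_add_iff 1).2 this
  refine Summable.tsum_le_tsum (fun n ↦ ?_) (hsum σ₂ (h1.trans_le h12)) (hsum σ₁ h1)
  have hn : (1 : ℝ) ≤ ((n + 1 : ℕ) : ℝ) := by exact_mod_cast Nat.le_add_left 1 n
  exact Real.rpow_le_rpow_of_exponent_le hn (by linarith)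

/-- **Hoffstein's bound on the line `Re s = −3/2` (the input of (1), p. 168)**: for `χ` primitive
modulo `q > 1` and real `t`,
`‖ζ(−3/2+it) L(−3/2+it, χ)‖ ≤ q² (9/4 + t²)(1/4 + t²) Z₀(5/2)² / (16 π⁴)`
(the source bounds `ζ_k(5/2) ≤ ζ(2)² = π⁴/36`; here `Z₀(5/2)² = ζ(5/2)²`).
[cite: Hoffstein1980SiegelTatuzawa, §2 proof of Lemma 1 (1) p. 168] -/
theorem norm_zetaL_neg_three_halves_le (hq : 1 < q) {χ : DirichletCharacter ℂ q}
    (hχ : χ.IsPrimitive) (t : ℝ) :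
    ‖zetaL χ (-3 / 2 + t * I)‖ ≤
      (q : ℝ) ^ 2 * ((9 / 4 + t ^ 2) * (1 / 4 + t ^ 2)) * bigZ (5 / 2) ^ 2 / (16 * π ^ 4) := by
  obtain ⟨c, hc, hL⟩ := norm_LFunction_neg_three_halves hq hχ t
  have hζ := norm_riemannZeta_neg_three_halves t
  set X₁ : ℝ := ‖((-3 / 4 : ℝ) : ℂ) + t / 2 * I‖ * ‖((-3 / 4 : ℝ) : ℂ) + t / 2 * I + 1‖ with hX₁
  set X₂ : ℝ := ‖(c : ℂ) + t / 2 * I‖ * ‖(c : ℂ) + t / 2 * I + 1‖ with hX₂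
  set P : ℝ := (9 / 4 + t ^ 2) * (1 / 4 + t ^ 2) with hP
  have hX₁sq : X₁ ^ 2 = P / 16 := norm_mul_norm_sq_eq t (Or.inl rfl)
  have hX₂sq : X₂ ^ 2 = P / 16 := norm_mul_norm_sq_eq t hc
  have hX₁0 : 0 ≤ X₁ := by positivity
  have hX₂0 : 0 ≤ X₂ := by positivity
  have hXX : X₁ * X₂ ≤ P / 16 := by nlinarith [sq_nonneg (X₁ - X₂)]
  have hZ : 0 ≤ bigZ (5 / 2) := (bigZ_pos (by norm_num)).le
  have hζb : ‖riemannZeta (5 / 2 - t * I)‖ ≤ bigZ (5 / 2) := by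
    have := norm_riemannZeta_le_bigZ (σ := 5 / 2) (by norm_num) (-t)
    convert this using 2; push_cast; ring
  have hLb : ‖χ⁻¹.LFunction (5 / 2 - t * I)‖ ≤ bigZ (5 / 2) := by
    have := norm_LFunction_le_bigZ χ⁻¹ (σ := 5 / 2) (by norm_num) (-t)
    convert this using 2; push_cast; ring
  unfold zetaL
  rw [norm_mul, hζ, hL]
  have hq0 : (0 : ℝ) < q := by exact_mod_cast (zero_lt_one.trans hq)
  have hπ := Real.pi_pos
  have hπ2 : π ^ (-2 : ℝ) = 1 / π ^ 2 := by
    rw [Real.rpow_neg hπ.le, Real.rpow_two, one_div]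
  rw [hπ2]
  calc X₁ * (1 / π ^ 2) * ‖riemannZeta (5 / 2 - t * I)‖ *
        (X₂ * ((q : ℝ) ^ 2 / π ^ 2) * ‖χ⁻¹.LFunction (5 / 2 - t * I)‖)
      = (X₁ * X₂) * (‖riemannZeta (5 / 2 - t * I)‖ * ‖χ⁻¹.LFunction (5 / 2 - t * I)‖) *
          ((q : ℝ) ^ 2 / π ^ 4) := by ring
    _ ≤ (P / 16) * (bigZ (5 / 2) * bigZ (5 / 2)) * ((q : ℝ) ^ 2 / π ^ 4) := by
        gcongr
    _ = _ := by rw [hP]; ring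

/-! ### Polynomial growth in the strip `−3/2 ≤ Re s ≤ 2` -/

open Literature.Analysis.SpecialFunctions.GammaStirling in
/-- Stirling for the `Γ`-quotient of a functional equation: there is `C > 0` with
`‖Γ(x₁ − it/2)‖ ≤ C |t/2|^{x₁ − x₂} ‖Γ(x₂ + it/2)‖` for all `x₁, x₂ ∈ [−1, 2]`, `|t| ≥ 2`.
[cite: MontgomeryVaughan2007, §10.1 Cor. 10.10] -/
theorem exists_norm_Gamma_quot_le :
    ∃ C : ℝ, 0 < C ∧ ∀ x₁ ∈ Icc (-1 : ℝ) 2, ∀ x₂ ∈ Icc (-1 : ℝ) 2, ∀ t : ℝ, 2 ≤ |t| →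
      ‖Gamma ((x₁ : ℂ) - t / 2 * I)‖ ≤ C * |t / 2| ^ (x₁ - x₂) * ‖Gamma ((x₂ : ℂ) + t / 2 * I)‖ := by
  obtain ⟨C, hC, h⟩ := exists_norm_Gamma_vertical_ratio_le (-1 : ℝ) 2
  refine ⟨C, hC, fun x₁ hx₁ x₂ hx₂ t ht ↦ ?_⟩
  have hu : 1 ≤ |t / 2| := by rw [abs_div, abs_two]; linarith
  have h1 := h x₁ hx₁ x₂ hx₂ (t / 2) hu
  have hconj : (x₁ : ℂ) - t / 2 * I = (starRingEnd ℂ) ((x₁ : ℂ) + ((t / 2 : ℝ) : ℂ) * I) := by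
    apply Complex.ext
    · rw [Complex.conj_re]; simp
    · rw [Complex.conj_im]; simp
  rw [hconj, Complex.Gamma_conj, Complex.norm_conj]
  convert h1 using 3
  · push_cast; ring

/-- Elementary size bounds for `s = σ + it` in the strip: `‖s‖ ≤ |t| + 5/2` etc. [folklore] -/
private lemma norm_le_abs_im_add {s : ℂ} {A : ℝ} (hσ : |s.re| ≤ A) : ‖s‖ ≤ |s.im| + A :=
  (norm_le_abs_re_add_abs_im s).trans (by linarith)

/-- **Polynomial growth of `ζ` in the strip** `−3/2 ≤ σ ≤ 2`, `|t| ≥ 2`: `‖ζ(σ+it)‖ ≤ C t²`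
(Titchmarsh (2.12.2) for `σ ≥ 1/4`; the functional equation and Stirling's formula for `σ < 1/4`).
[cite: MontgomeryVaughan2007, §10.1 Cor. 10.10] -/
theorem exists_norm_riemannZeta_le_sq :
    ∃ C : ℝ, 0 < C ∧ ∀ s : ℂ, -3 / 2 ≤ s.re → s.re ≤ 2 → 2 ≤ |s.im| →
      ‖riemannZeta s‖ ≤ C * s.im ^ 2 := by
  obtain ⟨C, hC, hΓ⟩ := exists_norm_Gamma_quot_le
  have hZ : 0 < bigZ (3 / 2) := bigZ_pos (by norm_num)
  refine ⟨6 + 6 * C + C * bigZ (3 / 2), by positivity, fun s hσ1 hσ2 ht ↦ ?_⟩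
  set σ := s.re with hσ
  set t := s.im with htdef
  have hst : s = σ + t * I := (re_add_im s).symm
  have ht0 : 0 < |t| := by linarith
  have ht2 : t ^ 2 = |t| ^ 2 := (sq_abs t).symm
  have hs1 : s ≠ 1 := fun h ↦ by
    have : t = 0 := by rw [htdef, h]; simp
    rw [this, abs_zero] at ht; linarith
  have hs0 : s ≠ 0 := fun h ↦ by
    have : t = 0 := by rw [htdef, h]; simp
    rw [this, abs_zero] at ht; linarith
  -- right half-plane: `‖ζ(w)‖ ≤ 11 |t|` for `1/4 ≤ Re w ≤ 5/2`, `|Im w| = |t|`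
  have hright : ∀ w : ℂ, 1 / 4 ≤ w.re → w.re ≤ 5 / 2 → |w.im| = |t| →
      ‖riemannZeta w‖ ≤ 11 * |t| := by
    intro w hw1 hw2 hwim
    have hw0 : 0 < w.re := by linarith
    have hw1' : w ≠ 1 := fun h ↦ by rw [h] at hwim; simp at hwim; linarith
    have h := norm_riemannZeta_le_of_re_pos hw0 hw1'
    have hnw : ‖w‖ ≤ |t| + 5 / 2 := by
      rw [← hwim]; exact norm_le_abs_im_add (abs_le.2 ⟨by linarith, by linarith⟩)
    have hw1n : 2 ≤ ‖w - 1‖ := by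
      have := abs_im_le_norm (w - 1); simp at this; rw [hwim] at this; linarith
    have h1 : ‖w‖ / ‖w - 1‖ ≤ ‖w‖ / 2 := div_le_div_of_nonneg_left (norm_nonneg _) (by norm_num) hw1n
    have h2 : ‖w‖ / w.re ≤ ‖w‖ / (1 / 4) :=
      div_le_div_of_nonneg_left (norm_nonneg _) (by norm_num) hw1
    calc ‖riemannZeta w‖ ≤ ‖w‖ / 2 + ‖w‖ / (1 / 4) := h.trans (add_le_add h1 h2)
      _ = (9 / 2) * ‖w‖ := by ring
      _ ≤ (9 / 2) * (|t| + 5 / 2) := by gcongr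
      _ ≤ 11 * |t| := by nlinarith
  have hrest : 0 ≤ (6 * C + C * bigZ (3 / 2)) * |t| ^ 2 := by positivity
  by_cases hcase : 1 / 4 ≤ σ
  · have h := hright s hcase (by linarith) rfl
    rw [ht2]; nlinarith
  push Not at hcase
  -- functional equation `ζ(s) = ζ(1-s) Γℝ(1-s)/Γℝ(s)`
  have h1s0 : (1 : ℂ) - s ≠ 0 := sub_ne_zero.2 hs1.symm
  have hre1 : 0 < ((1 : ℂ) - s).re := by simp; linarith
  have hζ : riemannZeta s = riemannZeta (1 - s) * (Gammaℝ (1 - s) / Gammaℝ s) := by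
    rw [riemannZeta_def_of_ne_zero hs0, ← completedRiemannZeta_one_sub,
      riemannZeta_def_of_ne_zero h1s0]
    field_simp [Complex.Gammaℝ_ne_zero_of_re_pos hre1]
  have hquot : ‖Gammaℝ (1 - s) / Gammaℝ s‖ ≤ C * |t / 2| ^ (1 / 2 - σ) := by
    rw [Complex.Gammaℝ_def, Complex.Gammaℝ_def, norm_div, norm_mul, norm_mul,
      Complex.norm_cpow_eq_rpow_re_of_pos Real.pi_pos, Complex.norm_cpow_eq_rpow_re_of_pos Real.pi_pos]
    have e1 : (1 - s) / 2 = (((1 - σ) / 2 : ℝ) : ℂ) - t / 2 * I := by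
      rw [hst]; push_cast; ring
    have e2 : s / 2 = ((σ / 2 : ℝ) : ℂ) + t / 2 * I := by rw [hst]; push_cast; ring
    have hG := hΓ ((1 - σ) / 2) ⟨by linarith, by linarith⟩ (σ / 2) ⟨by linarith, by linarith⟩ t ht
    rw [← e1, ← e2, show (1 - σ) / 2 - σ / 2 = 1 / 2 - σ by ring] at hG
    have hΓs : 0 < ‖Gamma (s / 2)‖ := by
      refine norm_pos_iff.2 (Complex.Gamma_ne_zero fun m hm ↦ ?_)
      have h' := congrArg Complex.im hm
      simp only [Complex.div_ofNat_im, neg_im, natCast_im, neg_zero] at h'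
      rw [← htdef] at h'
      have : t = 0 := by linarith
      rw [this, abs_zero] at ht0; exact lt_irrefl _ ht0
    have hr1 : (-(1 - s) / 2).re = -(1 - σ) / 2 := by simp [hσ]
    have hr2 : (-s / 2).re = -σ / 2 := by simp [hσ]
    rw [hr1, hr2]
    have hπ1 : π ^ (-(1 - σ) / 2) / π ^ (-σ / 2) = π ^ (σ - 1 / 2) := by
      rw [← Real.rpow_sub Real.pi_pos]; congr 1; ring
    have hπle : π ^ (σ - 1 / 2) ≤ 1 :=
      Real.rpow_le_one_of_one_le_of_nonpos (by linarith [Real.pi_gt_three]) (by linarith)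
    calc π ^ (-(1 - σ) / 2) * ‖Gamma ((1 - s) / 2)‖ / (π ^ (-σ / 2) * ‖Gamma (s / 2)‖)
        = (π ^ (-(1 - σ) / 2) / π ^ (-σ / 2)) * (‖Gamma ((1 - s) / 2)‖ / ‖Gamma (s / 2)‖) := by
          rw [mul_div_mul_comm]
      _ ≤ 1 * (C * |t / 2| ^ (1 / 2 - σ)) := by
          rw [hπ1]
          refine mul_le_mul hπle ?_ (by positivity) zero_le_one
          rw [div_le_iff₀ hΓs]; exact hG
      _ = _ := one_mul _
  have ht2' : 1 ≤ |t / 2| := by rw [abs_div, abs_two]; linarith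
  have htabs : |t / 2| = |t| / 2 := by rw [abs_div, abs_two]
  rw [hζ, norm_mul, ht2]
  by_cases hmid : -1 / 2 ≤ σ
  · -- `ζ(1-s) = O(|t|)`, quotient `≤ C |t/2|`
    have hz1 : ‖riemannZeta (1 - s)‖ ≤ 11 * |t| :=
      hright (1 - s) (by simp; linarith) (by simp; linarith) (by simp [htdef])
    have hrpow : |t / 2| ^ (1 / 2 - σ) ≤ |t / 2| := by
      calc |t / 2| ^ (1 / 2 - σ) ≤ |t / 2| ^ (1 : ℝ) :=
            Real.rpow_le_rpow_of_exponent_le ht2' (by linarith)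
        _ = |t / 2| := Real.rpow_one _
    have hq' : ‖Gammaℝ (1 - s) / Gammaℝ s‖ ≤ C * (|t| / 2) :=
      hquot.trans (by rw [← htabs]; exact mul_le_mul_of_nonneg_left hrpow hC.le)
    calc ‖riemannZeta (1 - s)‖ * ‖Gammaℝ (1 - s) / Gammaℝ s‖ ≤ (11 * |t|) * (C * (|t| / 2)) :=
          mul_le_mul hz1 hq' (norm_nonneg _) (by positivity)
      _ ≤ _ := by
          have : 0 ≤ (6 + C * bigZ (3 / 2)) * |t| ^ 2 := by positivity
          nlinarith
  · push Not at hmid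
    -- `Re(1-s) ≥ 3/2`: `‖ζ(1-s)‖ ≤ Z₀(3/2)`, quotient `≤ C t²/4`
    have hz1 : ‖riemannZeta (1 - s)‖ ≤ bigZ (3 / 2) := by
      have h32 : (3 : ℝ) / 2 ≤ 1 - σ := by linarith
      have hb := norm_riemannZeta_le_bigZ (σ := 1 - σ) (by linarith) (-t)
      have e : ((1 - σ : ℝ) : ℂ) + (-t : ℝ) * I = 1 - s := by rw [hst]; push_cast; ring
      rw [e] at hb
      exact hb.trans (bigZ_antitone' (by norm_num) h32)
    have hrpow : |t / 2| ^ (1 / 2 - σ) ≤ |t / 2| ^ (2 : ℝ) :=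
      Real.rpow_le_rpow_of_exponent_le ht2' (by linarith)
    have hq' : ‖Gammaℝ (1 - s) / Gammaℝ s‖ ≤ C * (|t| / 2) ^ 2 :=
      hquot.trans (by rw [← htabs, ← Real.rpow_two]; exact mul_le_mul_of_nonneg_left hrpow hC.le)
    calc ‖riemannZeta (1 - s)‖ * ‖Gammaℝ (1 - s) / Gammaℝ s‖ ≤ bigZ (3 / 2) * (C * (|t| / 2) ^ 2) :=
          mul_le_mul hz1 hq' (norm_nonneg _) hZ.le
      _ ≤ _ := by
          have : 0 ≤ (6 + 6 * C) * |t| ^ 2 := by positivity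
          nlinarith

/-- A primitive character modulo `q > 1` is non-trivial. [folklore] -/
private theorem ne_one_of_isPrimitive' {χ : DirichletCharacter ℂ q} (hχ : χ.IsPrimitive)
    (hq : 1 < q) : χ ≠ 1 := by
  rintro rfl
  have h : (1 : DirichletCharacter ℂ q).conductor = q := hχ
  rw [DirichletCharacter.conductor_one] at h
  omega

/-- **Polynomial growth of `L(s, χ)` in the strip** `−3/2 ≤ σ ≤ 2`, `|t| ≥ 2`, for a primitive
`χ` modulo `q > 1`: `‖L(σ+it, χ)‖ ≤ C t²` (MV Lemma 10.15 for `σ ≥ 1/4`; Rademacher's form of the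
functional equation and Stirling's formula for `σ < 1/4`).
[cite: MontgomeryVaughan2007, §10.1 Cor. 10.10] -/
theorem exists_norm_LFunction_le_sq (hq : 1 < q) {χ : DirichletCharacter ℂ q} (hχ : χ.IsPrimitive) :
    ∃ C : ℝ, 0 < C ∧ ∀ s : ℂ, -3 / 2 ≤ s.re → s.re ≤ 2 → 2 ≤ |s.im| →
      ‖χ.LFunction s‖ ≤ C * s.im ^ 2 := by
  obtain ⟨C, hC, hΓ⟩ := exists_norm_Gamma_quot_le
  have hq1 : q ≠ 1 := by omega
  have hχ1 : χ ≠ 1 := ne_one_of_isPrimitive' hχ hq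
  have hχ1' : χ⁻¹ ≠ 1 := inv_ne_one.2 hχ1
  have hqR : (0 : ℝ) < q := by exact_mod_cast (zero_lt_one.trans hq)
  set Z : ℝ := ∑' n : ℕ, ((n + 1 : ℕ) : ℝ) ^ (-(5 / 4 : ℝ)) with hZdef
  have hZ1 : 1 ≤ Z := DirichletZFR.one_le_tsum_rpow
  have hZ32 : 0 < bigZ (3 / 2) := bigZ_pos (by norm_num)
  set B : ℝ := ((q : ℝ) / π) ^ 2 + 1 with hB
  have hB1 : 1 ≤ B := by rw [hB]; nlinarith [sq_nonneg ((q : ℝ) / π)]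
  set K : ℝ := 3 * q * Z + B * C * (3 * q * Z) + B * C * bigZ (3 / 2) with hK
  refine ⟨K, by positivity, fun s hσ1 hσ2 ht ↦ ?_⟩
  set σ := s.re with hσ
  set t := s.im with htdef
  have hst : s = σ + t * I := (re_add_im s).symm
  have ht0 : 0 < |t| := by linarith
  have ht2 : t ^ 2 = |t| ^ 2 := (sq_abs t).symm
  -- MV Lemma 10.15 on the right: `‖L(w, ψ)‖ ≤ 3 q Z |t|` for `1/4 ≤ Re w ≤ 5/2`, `|Im w| = |t|`
  have hright : ∀ (ψ : DirichletCharacter ℂ q), ψ ≠ 1 → ∀ w : ℂ, 1 / 4 ≤ w.re → w.re ≤ 5 / 2 →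
      |w.im| = |t| → ‖ψ.LFunction w‖ ≤ 3 * q * Z * |t| := by
    intro ψ hψ w hw1 hw2 hwim
    have h := DirichletZFR.norm_LFunction_le_of_re_ge ψ hψ hw1
    have hnw : ‖w‖ ≤ |t| + 5 / 2 := by
      rw [← hwim]; exact norm_le_abs_im_add (abs_le.2 ⟨by linarith, by linarith⟩)
    calc ‖ψ.LFunction w‖ ≤ q * ‖w‖ * Z := h
      _ ≤ q * (|t| + 5 / 2) * Z := by gcongr
      _ ≤ 3 * q * Z * |t| := by
          have : (0 : ℝ) ≤ q * Z := by positivity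
          nlinarith
  have hrest1 : 0 ≤ (B * C * (3 * q * Z) + B * C * bigZ (3 / 2)) * |t| ^ 2 := by positivity
  have htt : |t| ≤ |t| ^ 2 := by nlinarith
  have hKge1 : 3 * q * Z ≤ K := by rw [hK]; nlinarith [hrest1]
  have hKge2 : B * C * (3 * q * Z) ≤ K := by
    rw [hK]; have : (0:ℝ) ≤ 3 * q * Z := by positivity
    have : (0:ℝ) ≤ B * C * bigZ (3 / 2) := by positivity
    linarith
  have hKge3 : B * C * bigZ (3 / 2) ≤ K := by
    rw [hK]; have : (0:ℝ) ≤ 3 * q * Z := by positivity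
    have : (0:ℝ) ≤ B * C * (3 * q * Z) := by positivity
    linarith
  by_cases hcase : 1 / 4 ≤ σ
  · have h := hright χ hχ1 s hcase (by linarith) rfl
    rw [ht2]
    have h3 : (0:ℝ) ≤ 3 * q * Z := by positivity
    calc ‖χ.LFunction s‖ ≤ 3 * q * Z * |t| := h
      _ ≤ 3 * q * Z * |t| ^ 2 := by gcongr
      _ ≤ K * |t| ^ 2 := by gcongr
  push Not at hcase
  -- Rademacher's reflection formula
  have hrefl := Rademacher1959.norm_LFunction_eq_reflect hq hχ (s := s) (by rw [← hσ]; linarith)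
  set a : ℕ := charParity χ with ha
  have ha1 : (a : ℝ) = 0 ∨ (a : ℝ) = 1 := by
    have := charParity_le_one χ; rw [← ha] at this
    rcases Nat.le_one_iff_eq_zero_or_eq_one.1 this with h | h
    · left; rw [h]; simp
    · right; rw [h]; simp
  have ha0 : (0 : ℝ) ≤ a := Nat.cast_nonneg a
  have ha1' : (a : ℝ) ≤ 1 := by rcases ha1 with h | h <;> linarith
  -- the power of `π/q`
  have hpow : (π / q : ℝ) ^ (σ - 1 / 2) ≤ B := by
    have hpq : 0 < (π / q : ℝ) := div_pos Real.pi_pos hqR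
    rcases le_or_gt (π / q : ℝ) 1 with hle | hgt
    · calc (π / q : ℝ) ^ (σ - 1 / 2) ≤ (π / q : ℝ) ^ (-2 : ℝ) :=
            Real.rpow_le_rpow_of_exponent_ge hpq hle (by linarith)
        _ = ((q : ℝ) / π) ^ 2 := by
            rw [Real.rpow_neg hpq.le, Real.rpow_two, ← inv_pow, inv_div]
        _ ≤ B := by rw [hB]; linarith
    · calc (π / q : ℝ) ^ (σ - 1 / 2) ≤ 1 :=
            Real.rpow_le_one_of_one_le_of_nonpos hgt.le (by linarith)
        _ ≤ B := hB1
  -- the `Γ`-quotient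
  have hquot : ‖Gamma ((a : ℂ) / 2 + (1 - s) / 2) / Gamma ((a : ℂ) / 2 + s / 2)‖ ≤
      C * |t / 2| ^ (1 / 2 - σ) := by
    have e1 : (a : ℂ) / 2 + (1 - s) / 2 = (((a : ℝ) / 2 + (1 - σ) / 2 : ℝ) : ℂ) - t / 2 * I := by
      rw [hst]; push_cast; ring
    have e2 : (a : ℂ) / 2 + s / 2 = (((a : ℝ) / 2 + σ / 2 : ℝ) : ℂ) + t / 2 * I := by
      rw [hst]; push_cast; ring
    have hG := hΓ ((a : ℝ) / 2 + (1 - σ) / 2) ⟨by linarith, by linarith⟩ ((a : ℝ) / 2 + σ / 2)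
      ⟨by linarith, by linarith⟩ t ht
    rw [← e1, ← e2, show (a : ℝ) / 2 + (1 - σ) / 2 - ((a : ℝ) / 2 + σ / 2) = 1 / 2 - σ by ring] at hG
    have hΓs : 0 < ‖Gamma ((a : ℂ) / 2 + s / 2)‖ := by
      refine norm_pos_iff.2 (Complex.Gamma_ne_zero fun m hm ↦ ?_)
      have h' := congrArg Complex.im hm
      rw [e2] at h'
      simp at h'
      rw [h', abs_zero] at ht0; exact lt_irrefl _ ht0
    rw [norm_div, div_le_iff₀ hΓs]; exact hG
  have ht2' : 1 ≤ |t / 2| := by rw [abs_div, abs_two]; linarith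
  have htabs : |t / 2| = |t| / 2 := by rw [abs_div, abs_two]
  have h1s : (1 - s).re = 1 - σ := by simp [hσ]
  rw [hrefl, ← hσ, ht2]
  by_cases hmid : -1 / 2 ≤ σ
  · have hz1 : ‖χ⁻¹.LFunction (1 - s)‖ ≤ 3 * q * Z * |t| :=
      hright χ⁻¹ hχ1' (1 - s) (by rw [h1s]; linarith) (by rw [h1s]; linarith) (by simp [htdef])
    have hrpow : |t / 2| ^ (1 / 2 - σ) ≤ |t / 2| := by
      calc |t / 2| ^ (1 / 2 - σ) ≤ |t / 2| ^ (1 : ℝ) :=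
            Real.rpow_le_rpow_of_exponent_le ht2' (by linarith)
        _ = |t / 2| := Real.rpow_one _
    have hq' : ‖Gamma ((a : ℂ) / 2 + (1 - s) / 2) / Gamma ((a : ℂ) / 2 + s / 2)‖ ≤ C * (|t| / 2) :=
      hquot.trans (by rw [← htabs]; exact mul_le_mul_of_nonneg_left hrpow hC.le)
    calc (π / q : ℝ) ^ (σ - 1 / 2) * ‖Gamma ((a : ℂ) / 2 + (1 - s) / 2) / Gamma ((a : ℂ) / 2 + s / 2)‖ *
          ‖χ⁻¹.LFunction (1 - s)‖ ≤ B * (C * (|t| / 2)) * (3 * q * Z * |t|) := by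
          gcongr
      _ = (B * C * (3 * q * Z)) * |t| ^ 2 / 2 := by ring
      _ ≤ (B * C * (3 * q * Z)) * |t| ^ 2 := by
          have h1 : 0 ≤ B * C * (3 * q * Z) * |t| ^ 2 := by positivity
          linarith
      _ ≤ K * |t| ^ 2 := by gcongr
  · push Not at hmid
    have hz1 : ‖χ⁻¹.LFunction (1 - s)‖ ≤ bigZ (3 / 2) := by
      have h32 : (3 : ℝ) / 2 ≤ 1 - σ := by linarith
      have hb := norm_LFunction_le_bigZ χ⁻¹ (σ := 1 - σ) (by linarith) (-t)
      have e : ((1 - σ : ℝ) : ℂ) + (-t : ℝ) * I = 1 - s := by rw [hst]; push_cast; ring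
      rw [e] at hb
      exact hb.trans (bigZ_antitone' (by norm_num) h32)
    have hrpow : |t / 2| ^ (1 / 2 - σ) ≤ |t / 2| ^ (2 : ℝ) :=
      Real.rpow_le_rpow_of_exponent_le ht2' (by linarith)
    have hq' : ‖Gamma ((a : ℂ) / 2 + (1 - s) / 2) / Gamma ((a : ℂ) / 2 + s / 2)‖ ≤ C * (|t| / 2) ^ 2 :=
      hquot.trans (by rw [← htabs, ← Real.rpow_two]; exact mul_le_mul_of_nonneg_left hrpow hC.le)
    calc (π / q : ℝ) ^ (σ - 1 / 2) * ‖Gamma ((a : ℂ) / 2 + (1 - s) / 2) / Gamma ((a : ℂ) / 2 + s / 2)‖ *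
          ‖χ⁻¹.LFunction (1 - s)‖ ≤ B * (C * (|t| / 2) ^ 2) * bigZ (3 / 2) := by
          gcongr
      _ = (B * C * bigZ (3 / 2)) * |t| ^ 2 / 4 := by ring
      _ ≤ (B * C * bigZ (3 / 2)) * |t| ^ 2 := by
          have h1 : 0 ≤ B * C * bigZ (3 / 2) * |t| ^ 2 := by positivity
          linarith
      _ ≤ K * |t| ^ 2 := by gcongr

/-- **Polynomial growth of `F = ζ · L(·, χ)` in the strip** `−3/2 ≤ σ ≤ 2`, `|t| ≥ 2`:
`‖F(σ + it)‖ ≤ C t⁴` — the estimate that kills the horizontal sides when the line of integration in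
Hoffstein's (3) is moved from `Re s = 2` to `Re s = −3/2 − β` against the kernel `≍ |t|^{-6}`.
[cite: Hoffstein1980SiegelTatuzawa, §2 proof of Lemma 1 (3) p. 169] -/
theorem exists_norm_zetaL_le_pow (hq : 1 < q) {χ : DirichletCharacter ℂ q} (hχ : χ.IsPrimitive) :
    ∃ C : ℝ, 0 < C ∧ ∀ s : ℂ, -3 / 2 ≤ s.re → s.re ≤ 2 → 2 ≤ |s.im| →
      ‖zetaL χ s‖ ≤ C * s.im ^ 4 := by
  obtain ⟨C₁, hC₁, h₁⟩ := exists_norm_riemannZeta_le_sq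
  obtain ⟨C₂, hC₂, h₂⟩ := exists_norm_LFunction_le_sq hq hχ
  refine ⟨C₁ * C₂, mul_pos hC₁ hC₂, fun s hσ1 hσ2 ht ↦ ?_⟩
  unfold zetaL
  rw [norm_mul]
  calc ‖riemannZeta s‖ * ‖χ.LFunction s‖ ≤ (C₁ * s.im ^ 2) * (C₂ * s.im ^ 2) :=
        mul_le_mul (h₁ s hσ1 hσ2 ht) (h₂ s hσ1 hσ2 ht) (norm_nonneg _) (by positivity)
    _ = C₁ * C₂ * s.im ^ 4 := by ring


/-! ### Signs on the real axis ("−ζ_k(−2+β) < 0 and ζ_k(β) ≤ 0", p. 169) -/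

open Literature.NumberTheory.LFunctions.DirichletAbel in
/-- **`ζ_k(β) ≤ 0`**: for a quadratic `χ ≠ 1` and real `0 < σ < 1` with `L(σ, χ) ≥ 0` (e.g. no zero of
`L(·, χ)` on `[σ, 1]`), `F(σ) = ζ(σ) L(σ, χ)` is a real number `≤ 0` (`ζ(σ) < 0` on `(0,1)`).
[cite: Hoffstein1980SiegelTatuzawa, §2 proof of Lemma 1 p. 169] -/
theorem zetaL_ofReal_re_nonpos {χ : DirichletCharacter ℂ q} (hχ1 : χ ≠ 1) (hq2 : χ ^ 2 = 1) {σ : ℝ}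
    (h0 : 0 < σ) (h1 : σ < 1) (hL : 0 ≤ (χ.LFunction σ).re) :
    (zetaL χ σ).re ≤ 0 ∧ (zetaL χ σ).im = 0 := by
  have hζ := Complex.neg_iff.1 (riemannZeta_neg_of_pos_of_lt_one h0 h1)
  have hLim : (χ.LFunction σ).im = 0 := LFunction_ofReal_im_eq_zero χ hχ1 hq2 h0
  unfold zetaL
  rw [mul_re, mul_im, hζ.2, hLim]
  simp only [mul_zero, sub_zero, zero_mul, add_zero]
  exact ⟨mul_nonpos_of_nonpos_of_nonneg hζ.1.le hL, trivial⟩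

/-- `Γ(x) < 0` for `−1 < x < 0` (`Γ(x) = Γ(x+1)/x`). [folklore] -/
private lemma Real_Gamma_neg_of_mem_Ioo {x : ℝ} (h1 : -1 < x) (h2 : x < 0) : Real.Gamma x < 0 := by
  have hx : x ≠ 0 := h2.ne
  have h := Real.Gamma_add_one hx
  have hpos : 0 < Real.Gamma (x + 1) := Real.Gamma_pos_of_pos (by linarith)
  rw [h] at hpos
  nlinarith [mul_pos_iff.1 hpos]

/-- `Γ_ℝ(x) = π^{-x/2} Γ(x/2)` is real for real `x`: `Γ_ℝ(x) = ofReal (π^{-x/2} Γ(x/2))`. [folklore] -/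
private lemma Gammaℝ_ofReal (x : ℝ) :
    Gammaℝ (x : ℂ) = ((π ^ (-x / 2) * Real.Gamma (x / 2) : ℝ) : ℂ) := by
  rw [Complex.Gammaℝ_def]
  have e1 : (-(x : ℂ) / 2) = ((-x / 2 : ℝ) : ℂ) := by push_cast; ring
  have e2 : ((x : ℂ) / 2) = ((x / 2 : ℝ) : ℂ) := by push_cast; ring
  rw [e1, e2, ← Complex.ofReal_cpow Real.pi_pos.le, Complex.Gamma_ofReal]
  push_cast
  ring

/-- **`ζ(σ) < 0` for `−2 < σ < −1`** (real): `ζ(σ) = ζ(1−σ) Γ_ℝ(1−σ)/Γ_ℝ(σ)` with `ζ(1−σ) > 0`,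
`Γ_ℝ(1−σ) > 0` and `Γ(σ/2) < 0` for `σ/2 ∈ (−1, −1/2)`. [cite: Hoffstein1980SiegelTatuzawa, §2 proof of Lemma 1 p. 169] -/
theorem riemannZeta_ofReal_neg_of_mem_Ioo {σ : ℝ} (h1 : -2 < σ) (h2 : σ < -1) :
    (riemannZeta σ).re < 0 ∧ (riemannZeta σ).im = 0 := by
  have hs0 : (σ : ℂ) ≠ 0 := by exact_mod_cast (show σ ≠ 0 by linarith)
  have h1s0 : (1 : ℂ) - σ ≠ 0 := by
    rw [show (1 : ℂ) - σ = ((1 - σ : ℝ) : ℂ) by push_cast; ring]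
    exact_mod_cast (show 1 - σ ≠ 0 by linarith)
  have hre1 : 0 < ((1 : ℂ) - σ).re := by simp; linarith
  have hζ : riemannZeta σ = riemannZeta (1 - σ) * Gammaℝ (1 - σ) / Gammaℝ σ := by
    rw [riemannZeta_def_of_ne_zero hs0, ← completedRiemannZeta_one_sub, riemannZeta_def_of_ne_zero h1s0]
    field_simp [Complex.Gammaℝ_ne_zero_of_re_pos hre1]
  -- the three real factors
  have hz1 : riemannZeta (1 - σ) = ((bigZ (1 - σ) : ℝ) : ℂ) := by
    rw [show (1 : ℂ) - σ = ((1 - σ : ℝ) : ℂ) by push_cast; ring]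
    apply Complex.ext
    · rw [ofReal_re, bigZ]
    · rw [ofReal_im, riemannZeta_im_eq_zero_of_pos (by linarith) (by linarith)]
  have hZpos : 0 < bigZ (1 - σ) := bigZ_pos (by linarith)
  have hG1 : Gammaℝ (1 - (σ : ℂ)) = ((π ^ (-(1 - σ) / 2) * Real.Gamma ((1 - σ) / 2) : ℝ) : ℂ) := by
    rw [show (1 : ℂ) - σ = ((1 - σ : ℝ) : ℂ) by push_cast; ring, Gammaℝ_ofReal]
  have hG1pos : 0 < π ^ (-(1 - σ) / 2) * Real.Gamma ((1 - σ) / 2) :=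
    mul_pos (Real.rpow_pos_of_pos Real.pi_pos _) (Real.Gamma_pos_of_pos (by linarith))
  have hG0 : Gammaℝ (σ : ℂ) = ((π ^ (-σ / 2) * Real.Gamma (σ / 2) : ℝ) : ℂ) := Gammaℝ_ofReal σ
  have hG0neg : π ^ (-σ / 2) * Real.Gamma (σ / 2) < 0 :=
    mul_neg_of_pos_of_neg (Real.rpow_pos_of_pos Real.pi_pos _)
      (Real_Gamma_neg_of_mem_Ioo (by linarith) (by linarith))
  rw [hζ, hz1, hG1, hG0, ← ofReal_mul, ← ofReal_div]
  refine ⟨?_, ofReal_im _⟩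
  rw [ofReal_re]
  exact div_neg_of_pos_of_neg (mul_pos hZpos hG1pos) hG0neg

open Literature.NumberTheory.LFunctions.DirichletAbel
  Literature.NumberTheory.LFunctions.PrimitiveQuadratic in
/-- **`L(σ, χ) < 0` for `−2 < σ < −1`** and a real primitive `χ` modulo `q > 1`: by the functional
equation `Λ(σ, χ) = q^{1/2−σ} ε(χ) Λ(1−σ, χ)` with `ε(χ) = 1` (real `χ`), `Λ(1−σ, χ) > 0`, and the
Archimedean factor `Γ_ℝ(σ + a)` is negative (`(σ+a)/2 ∈ (−1, 0)` for `a ∈ {0,1}`).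
[cite: Hoffstein1980SiegelTatuzawa, §2 proof of Lemma 1 p. 169] -/
theorem LFunction_ofReal_neg_of_mem_Ioo (hq : 1 < q) {χ : DirichletCharacter ℂ q} (hχ : χ.IsPrimitive)
    (hquad : χ.IsQuadratic) {σ : ℝ} (h1 : -2 < σ) (h2 : σ < -1) :
    (χ.LFunction σ).re < 0 ∧ (χ.LFunction σ).im = 0 := by
  have hq1 : q ≠ 1 := by omega
  have hq2 : χ ^ 2 = 1 := hquad.sq_eq_one
  have hinv : χ⁻¹ = χ := hquad.inv
  have hqR : (0 : ℝ) < q := by exact_mod_cast (zero_lt_one.trans hq)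
  set a : ℕ := charParity χ with ha
  have hγ : ∀ w : ℂ, gammaFactor χ w = Gammaℝ (w + a) := by
    intro w
    rcases χ.even_or_odd with h | h
    · rw [h.gammaFactor_def, ha, charParity_of_even h, Nat.cast_zero, add_zero]
    · rw [h.gammaFactor_def, ha, charParity_of_odd h, Nat.cast_one]
  have ha1 : (a : ℝ) = 0 ∨ (a : ℝ) = 1 := by
    have := charParity_le_one χ; rw [← ha] at this
    rcases Nat.le_one_iff_eq_zero_or_eq_one.1 this with h | h
    · left; rw [h]; simp
    · right; rw [h]; simp
  -- `L(σ) = Λ(σ)/γ(σ)` and `L(1-σ) = Λ(1-σ)/γ(1-σ)`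
  have hL := LFunction_eq_completed_div_gammaFactor χ (σ : ℂ) (Or.inr hq1)
  have hL1 := LFunction_eq_completed_div_gammaFactor χ ((1 - σ : ℝ) : ℂ) (Or.inr hq1)
  -- functional equation
  have hFE := hχ.completedLFunction_one_sub ((1 - σ : ℝ) : ℂ)
  rw [rootNumber_eq_one_of_isQuadratic hχ hquad, mul_one, hinv,
    show (1 : ℂ) - ((1 - σ : ℝ) : ℂ) = (σ : ℂ) by push_cast; ring] at hFE
  -- `γ(1-σ) ≠ 0`, so `Λ(1-σ) = γ(1-σ) L(1-σ)`
  have hγ1 : gammaFactor χ ((1 - σ : ℝ) : ℂ) = ((π ^ (-(1 - σ + a) / 2) * Real.Gamma ((1 - σ + a) / 2) : ℝ) : ℂ) := by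
    rw [hγ, show ((1 - σ : ℝ) : ℂ) + (a : ℂ) = ((1 - σ + a : ℝ) : ℂ) by push_cast; ring, Gammaℝ_ofReal]
  have hγ1pos : 0 < π ^ (-(1 - σ + a) / 2) * Real.Gamma ((1 - σ + a) / 2) :=
    mul_pos (Real.rpow_pos_of_pos Real.pi_pos _) (Real.Gamma_pos_of_pos (by
      rcases ha1 with h | h <;> rw [h] <;> linarith))
  have hγ0 : gammaFactor χ (σ : ℂ) = ((π ^ (-(σ + a) / 2) * Real.Gamma ((σ + a) / 2) : ℝ) : ℂ) := by
    rw [hγ, show (σ : ℂ) + (a : ℂ) = ((σ + a : ℝ) : ℂ) by push_cast; ring, Gammaℝ_ofReal]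
  have hγ0neg : π ^ (-(σ + a) / 2) * Real.Gamma ((σ + a) / 2) < 0 :=
    mul_neg_of_pos_of_neg (Real.rpow_pos_of_pos Real.pi_pos _)
      (Real_Gamma_neg_of_mem_Ioo (by rcases ha1 with h | h <;> rw [h] <;> linarith)
        (by rcases ha1 with h | h <;> rw [h] <;> linarith))
  have hL1val : χ.LFunction ((1 - σ : ℝ) : ℂ) = (((χ.LFunction ((1 - σ : ℝ) : ℂ)).re : ℝ) : ℂ) := by
    apply Complex.ext
    · rw [ofReal_re]
    · rw [ofReal_im, LFunction_ofReal_im_eq_zero χ (ne_one_of_isPrimitive' hχ hq) hq2 (by linarith)]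
  have hL1pos : 0 < (χ.LFunction ((1 - σ : ℝ) : ℂ)).re :=
    LFunction_ofReal_re_pos_of_one_lt χ hq2 (by linarith)
  have hΛ1 : completedLFunction χ ((1 - σ : ℝ) : ℂ) =
      gammaFactor χ ((1 - σ : ℝ) : ℂ) * χ.LFunction ((1 - σ : ℝ) : ℂ) := by
    have hne : gammaFactor χ ((1 - σ : ℝ) : ℂ) ≠ 0 := by
      rw [hγ1]; exact_mod_cast hγ1pos.ne'
    rw [hL1]; field_simp
  have hqpow : (q : ℂ) ^ (((1 - σ : ℝ) : ℂ) - 1 / 2) = (((q : ℝ) ^ (1 / 2 - σ) : ℝ) : ℂ) := by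
    rw [show ((1 - σ : ℝ) : ℂ) - 1 / 2 = ((1 / 2 - σ : ℝ) : ℂ) by push_cast; ring,
      Complex.ofReal_cpow hqR.le]
    push_cast
    rfl
  have hqpos : 0 < (q : ℝ) ^ (1 / 2 - σ) := Real.rpow_pos_of_pos hqR _
  rw [hL, hFE, hΛ1, hqpow, hγ1, hγ0, hL1val, ← ofReal_mul, ← ofReal_mul, ← ofReal_div]
  refine ⟨?_, ofReal_im _⟩
  rw [ofReal_re]
  apply div_neg_of_pos_of_neg _ hγ0neg
  first
    | exact mul_pos (mul_pos hqpos hγ1pos) hL1pos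
    | exact mul_pos hqpos (mul_pos hγ1pos hL1pos)

/-- **`−ζ_k(−2+β) < 0`, i.e. `F(σ) > 0` for `−2 < σ < −1`** (`σ = β − 2`, `0 < β < 1`), for a real
primitive `χ` modulo `q > 1`: both `ζ(σ)` and `L(σ, χ)` are negative there.
[cite: Hoffstein1980SiegelTatuzawa, §2 proof of Lemma 1 p. 169] -/
theorem zetaL_ofReal_pos_of_mem_Ioo (hq : 1 < q) {χ : DirichletCharacter ℂ q} (hχ : χ.IsPrimitive)
    (hquad : χ.IsQuadratic) {σ : ℝ} (h1 : -2 < σ) (h2 : σ < -1) :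
    0 < (zetaL χ σ).re ∧ (zetaL χ σ).im = 0 := by
  obtain ⟨hζre, hζim⟩ := riemannZeta_ofReal_neg_of_mem_Ioo h1 h2
  obtain ⟨hLre, hLim⟩ := LFunction_ofReal_neg_of_mem_Ioo hq hχ hquad h1 h2
  unfold zetaL
  rw [mul_re, mul_im, hζim, hLim]
  simp only [mul_zero, sub_zero, zero_mul, add_zero]
  exact ⟨mul_pos_of_neg_of_neg hζre hLre, trivial⟩

end Literature.NumberTheory.LFunctions.Hoffstein1980

end
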